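import Mathlib
import Literature.AlgebraicGeometry.Resolution.FormalAxisOfNearChain
import Literature.AlgebraicGeometry.Resolution.OrderAlongFormalBranch
import HarnessLib

/-!
# Route `RadicialJung`, crux `CleanModels` (stmt-ResolutionOfSingularities-15917), line `Sketch` rev 35, stub 6 `stub_cleanProp44` (X44c),
# `τ = 1` residual, (B5″): A STRAIGHTENED INFINITE CHAIN IS CARRIED BY AN ALGEBRAIC `Σ_μ`-CURVE — the two tree theorems composed

Seat decomp-res-hand-2 g13 (structural hand: «reduce to the most general landed lemma, then specialise»).  hand-2 g12's hand argument for (B5″)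
(memo `Cruxes/CleanModels/Lines/Sketch-memo-hand2-g12-stubs-5-7.md` §4 (c): an infinite unbranched chain of maximal-contact births with `δ*` constant
is STRAIGHT in corrected coordinates `t̂ = t + ĝ^p / v`, `û₂ = u₂ − Σ α_k u₁^{k+1}`; the formal axis `V(t̂, û₂)` lies in `Σ̂_μ`; by excellence it is a
branch of an ALGEBRAIC `Σ_μ`-curve `𝒜 ∋ c`, which the `o`-priority blows up before inserting at `c`) uses, for its analytic middle, exactly the two tree
theorems of the non-clean T1 line ([CoP1] Prop. 4.4 proof, p. 11):

* ✓ `Literature.AlgebraicGeometry.Resolution.exists_prime_ne_maximalIdeal_map_le_pow` (`FormalAxisOfNearChain.lean`): corrected parameters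
  `z⁽ᴺ⁾ → ŷ` with `J ⊆ (z₂⁽ᴺ⁾, z₃⁽ᴺ⁾)^μ + (u^{N+1})` for all `N` give a formal prime `𝔓 ≠ 𝔪̂` of `R̂` with `J R̂ ⊆ 𝔓^μ`;
* ✓ `Literature.AlgebraicGeometry.Resolution.map_le_pow_maximalIdeal_localization_under` (`OrderAlongFormalBranch.lean`): for a local G-ring,
  `𝔮 = 𝔓 ∩ R` has `J R_𝔮 ⊆ (𝔮 R_𝔮)^μ`.

This file COMPOSES them into the statement the births dictionary will consume (no new mathematics; the value is the certified composition, with the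
non-maximality of `𝔮` made explicit):

* `births_axis_exists_prime` — **for a regular local G-ring `(R, 𝔪)` of dimension `3` with regular system of parameters `(u, y₂, y₃)`, corrected
  parameters `z₂⁽ᴺ⁾, z₃⁽ᴺ⁾` (`z⁽⁰⁾ = y`, `z⁽ᴺ⁺¹⁾ − z⁽ᴺ⁾ ∈ 𝔪^{N+2}`) and an ideal `J` with `J ⊆ (z₂⁽ᴺ⁾, z₃⁽ᴺ⁾)^μ + (u^{N+1})` for every `N`, there is a
  prime `𝔮 ≠ 𝔪` of `R` with `J R_𝔮 ⊆ (𝔮 R_𝔮)^μ`** — an algebraic `Σ_μ`-branch through the closed point (in the dictionary: `u = u₁`, `y₂ = t` the leaf,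
  `y₃ = u₂`, `z₂⁽ᴺ⁾ = t + (Σ_{k<N} u₁^{kd} q_k)^p / v`, `z₃⁽ᴺ⁾ = u₂ − Σ_{k<N} α_k u₁^{k+1}`; the containment is ✓ `births_chain_axis_mem` (p822199) read at
  generation `N`).
* `births_axis_not_isolated` — contrapositive in the currency of ✓ `Literature.….not_map_le_pow_of_isolated`: such a chain cannot sit over a point that is
  ISOLATED in `Σ_μ` (no non-maximal prime `𝔮` with `J R_𝔮 ⊆ (𝔮R_𝔮)^μ`).

What this does NOT do: the leaf step («`𝒜` lies in an algebraic representative of the leaf class», the `p`-th-power descent ✓ `…PthPowerDescentGRing.lean`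
applied along the branch) and the strategy-order contradiction are dictionary business (O1); (B5″), the hypotheses of ✓ `cleanProp44_of_tauOneResidual`,
X44c, `CleanModels` and resolution in characteristic `p` are NOT proved here.  OURS (composition of tree theorems).
-/

set_option linter.dupNamespace false -- mandated namespace of this single-conjunct summit

noncomputable section

open IsLocalRing
open Literature.AlgebraicGeometry.Resolution

namespace Summit.ResolutionOfSingularities.ResolutionOfSingularities.Theorems.RadicialJung.CleanModels

universe u

/-- **A straightened infinite chain is carried by an algebraic `Σ_μ`-branch.**  `R` a regular local ring of dimension `3` which is a G-ring, `(u, y₂, y₃)` a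
regular system of parameters, `z₂⁽ᴺ⁾, z₃⁽ᴺ⁾` corrected parameters converging `𝔪`-adically (`z⁽ᴺ⁺¹⁾ − z⁽ᴺ⁾ ∈ 𝔪^{N+2}`, `z⁽⁰⁾ = y`), and `J` an ideal with
`J ⊆ (z₂⁽ᴺ⁾, z₃⁽ᴺ⁾)^μ + (u^{N+1})` for all `N`.  Then some prime `𝔮 ≠ 𝔪` of `R` has `J R_𝔮 ⊆ (𝔮 R_𝔮)^μ` (`ord_𝔮 J ≥ μ`: a `Σ_μ`-curve through the closed
point).  Composition of ✓ `exists_prime_ne_maximalIdeal_map_le_pow` (formal axis) and ✓ `map_le_pow_maximalIdeal_localization_under` (excellence).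
[cite: CossartPiltant2008, Prop. 4.4 (proof, p. 11)] [cite: Matsumura1987, §32 p. 256] -/
theorem births_axis_exists_prime {R : Type u} [CommRing R] [IsRegularLocalRing R] (hG : IsGRing R)
    (u y₂ y₃ : R) (hgen : Ideal.span {u, y₂, y₃} = maximalIdeal R) (hdim : ringKrullDim R = 3)
    (z₂ z₃ : ℕ → R) (hz₂ : ∀ n, z₂ (n + 1) - z₂ n ∈ maximalIdeal R ^ (n + 2))
    (hz₃ : ∀ n, z₃ (n + 1) - z₃ n ∈ maximalIdeal R ^ (n + 2)) (h0₂ : z₂ 0 = y₂) (h0₃ : z₃ 0 = y₃)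
    (J : Ideal R) (μ : ℕ)
    (hJ : ∀ N, J ≤ Ideal.span {z₂ N, z₃ N} ^ μ ⊔ Ideal.span {u ^ (N + 1)}) :
    ∃ (𝔮 : Ideal R) (_ : 𝔮.IsPrime), 𝔮 ≠ maximalIdeal R ∧
      J.map (algebraMap R (Localization.AtPrime 𝔮)) ≤ maximalIdeal (Localization.AtPrime 𝔮) ^ μ := by
  obtain ⟨𝔓, h𝔓, hne, hle⟩ :=
    exists_prime_ne_maximalIdeal_map_le_pow u y₂ y₃ hgen hdim z₂ z₃ hz₂ hz₃ h0₂ h0₃ J μ hJ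
  haveI := h𝔓
  refine ⟨𝔓.under R, inferInstance, ?_, map_le_pow_maximalIdeal_localization_under hG J μ 𝔓 hle⟩
  -- `𝔓 ∩ R ≠ 𝔪`: otherwise `𝔪̂ = 𝔪 R̂ ⊆ 𝔓`, forcing `𝔓 = 𝔪̂`
  intro h
  apply hne
  have hmap : (𝔓.under R).map (algebraMap R (AdicCompletion (maximalIdeal R) R)) ≤ 𝔓 := Ideal.map_comap_le
  rw [h, ← AdicCompletion.maximalIdeal_eq_map] at hmap
  exact ((IsLocalRing.maximalIdeal.isMaximal _).eq_of_le h𝔓.ne_top hmap).symm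

/-- **Contrapositive: a straightened infinite chain cannot sit over an ISOLATED point of `Σ_μ`** — if no non-maximal prime `𝔮` of `R` has
`J R_𝔮 ⊆ (𝔮R_𝔮)^μ` (the ring form of isolation, ✓ `Literature.….not_map_le_pow_of_isolated`), the corrected parameters of the statement above cannot
exist. [cite: CossartPiltant2008, Prop. 4.4 (proof, p. 11)] -/
theorem births_axis_not_isolated {R : Type u} [CommRing R] [IsRegularLocalRing R] (hG : IsGRing R)
    (u y₂ y₃ : R) (hgen : Ideal.span {u, y₂, y₃} = maximalIdeal R) (hdim : ringKrullDim R = 3)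
    (z₂ z₃ : ℕ → R) (hz₂ : ∀ n, z₂ (n + 1) - z₂ n ∈ maximalIdeal R ^ (n + 2))
    (hz₃ : ∀ n, z₃ (n + 1) - z₃ n ∈ maximalIdeal R ^ (n + 2)) (h0₂ : z₂ 0 = y₂) (h0₃ : z₃ 0 = y₃)
    (J : Ideal R) (μ : ℕ)
    (hisol : ∀ (𝔮 : Ideal R) [𝔮.IsPrime], 𝔮 ≠ maximalIdeal R →
      ¬ J.map (algebraMap R (Localization.AtPrime 𝔮)) ≤ maximalIdeal (Localization.AtPrime 𝔮) ^ μ) :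
    ¬ ∀ N, J ≤ Ideal.span {z₂ N, z₃ N} ^ μ ⊔ Ideal.span {u ^ (N + 1)} := by
  intro hJ
  obtain ⟨𝔮, h𝔮, hne, hle⟩ := births_axis_exists_prime hG u y₂ y₃ hgen hdim z₂ z₃ hz₂ hz₃ h0₂ h0₃ J μ hJ
  exact hisol 𝔮 hne hle

end Summit.ResolutionOfSingularities.ResolutionOfSingularities.Theorems.RadicialJung.CleanModels

end
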